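import Summits.HodgeConjecture.HodgeConjecture.Theorems.F0P3KitOfRecordPins             -- ★ p822315 (K1): `isPinned_kitOfRecord (hdef h2 hμv hram hx)`
import Summits.HodgeConjecture.HodgeConjecture.Theorems.F0P3KitOfRecordLaws             -- (K7) `laws_kitOfRecord_of`, `tokenInf_kitOfRecord_of`
import Summits.HodgeConjecture.HodgeConjecture.Theorems.F0P3RamClsOfRecordAntihol        -- ★ (B-p08 (g20), «RC» + R-23): `ramCls₀`, `mem_ramCls₀_iff_not_isSpherical`, `ramCls₀_rep_cl_finite_of_isCot`
import Summits.HodgeConjecture.HodgeConjecture.Theorems.F0P3AntiholCohUnitaryToken       -- ★ p821880 (p02 (g7), (B-ii)): `tokenInfU_of_isCot`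
import Summits.HodgeConjecture.HodgeConjecture.Theorems.F0P3LocalIsotypyFinOfRecord       -- ★ (p02 (g7), #22): `localIsotypyFin₀_of_hAF`
import HarnessLib

/-!
# Crux `H413` — T5 ED. 4, K1′ + K7 ED. 2: **the kit of record AT `ramCls₀ := F0P3RamClsOfRecord.ramCls₀` is PINNED with NO residual hypothesis** (beyond the compact
# CM frame and the Haar family), and its `Laws` with rows #16 (both cotangent types) and #22 (from `hAF`) now INLINE

PLAN.F0P3g5 §5 K1∕K7, RULINGS (V36)(g), (V37)(5), (V38)(2)(3), R-23 (REF1).  With ★ «RC» (B-p08 (g20): `F0P3RamClsOfRecord` p822034 + `…Transport` + `…Antihol`) the two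
residual pin hypotheses of ★ K1 `isPinned_kitOfRecord` close: `hram := (mem_ramCls₀_iff_not_isSpherical).2` (R-12: `ramCls₀` IS the exact non-sphericity set) and pin (x)
`hx := ramCls₀_rep_cl_finite_of_isCot` (hol ★ Matsushima + antihol ★ via `P ↦ P̄`, R-23).  With ★ (B-ii) `tokenInfU_of_isCot` law #16 `TokenInf` holds at 𝔠₀ for BOTH
disjuncts of the head's guard `IsCot`; with ★ #22 `localIsotypyFin₀_of_hAF` law `LocalIsotypyFin` is the print-true finite half of «AutomorphicFlathAdmissible» (`hAF`, k = 1).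
* §1 **`isPinned_kitOfRecord₀ (hdef) (h2) (hμv) : (kitOfRecord … F0P3RamClsOfRecord.ramCls₀).IsPinned`** — pins (i)–(x), zero residual hypotheses.
* §2 `tokenInf_kitOfRecord (hdef) (h2) : 𝔠₀.TokenInf` (any `ramCls₀`) · `localIsotypyFin_kitOfRecord_of_hAF (hAF) : 𝔠₀.LocalIsotypyFin`.
* §3 **`laws_kitOfRecord_of₂`** = ★ K7 `laws_kitOfRecord_of` with `hTokA` DISCHARGED and `h22` REPLACED by `hAF` (one named hypothesis per remaining row).
No `sorry`, no named fact, no definition; `--supports stmt-HodgeConjecture-24833 --as helper`.  HONEST LABEL: HC_CM is proved only modulo the printed citations until rung 0 closes.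
-/

set_option autoImplicit false
set_option linter.dupNamespace false

-- Mathlib idiom (★ (𝔤,K) files): commutator bracket on `Module.End ℂ M`, to MENTION the token binders of law `TokenInf`.
attribute [local instance 100] LieRing.ofAssociativeRing

noncomputable section

open NumberField IsDedekindDomain MeasureTheory
open Literature.NumberTheory.Rogawski1990 Literature.NumberTheory.GaloisRepresentations
open Literature.NumberTheory.Automorphic Literature.NumberTheory.Automorphic.UnitaryGroup
open Literature.NumberTheory.Automorphic.UnitaryGroup.CotangentForms
open Literature.RepresentationTheory.BorelWallach2000 Literature.RepresentationTheory.KonnoKonno2007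
open scoped Matrix ComplexOrder

namespace Summit.HodgeConjecture.HodgeConjecture.Cruxes.H413.F0P3KitOfRecord

open Summit.HodgeConjecture.HodgeConjecture.Cruxes.H413.F0P3InnerFormClassificationV6
open Summit.HodgeConjecture.HodgeConjecture.Cruxes.H413.F0P3ClassTokensOfRecord (Cls cl rep mult)
open Summit.HodgeConjecture.HodgeConjecture.Cruxes.H413.F0P3RamClsOfRecord (ramCls₀ mem_ramCls₀_iff_not_isSpherical)
open Summit.HodgeConjecture.HodgeConjecture.Cruxes.H413.F0P3RamClsOfRecordAntihol (ramCls₀_rep_cl_finite_of_isCot)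
open Summit.HodgeConjecture.HodgeConjecture.Cruxes.H413.F0P3AntiholCohUnitaryToken (tokenInfU_of_isCot)
open Summit.HodgeConjecture.HodgeConjecture.Cruxes.H413.F0P3LocalIsotypyFinOfRecord (localIsotypyFin₀_of_hAF)
open Summit.HodgeConjecture.HodgeConjecture.Cruxes.H413.F0P3XiArchPacketOfRecord (JInfNoDegOne DsInfNoDegOne)
open Summit.HodgeConjecture.HodgeConjecture.Cruxes.H413.F0P3SemilocalTestFunctionsOfRecord (TestS₀)
open Summit.HodgeConjecture.HodgeConjecture.Cruxes.H413.F0P3bArchDegOneClass (archDegOneClass)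

variable (L : Type) [Field L] [NumberField L] [IsCMField L] (H : Matrix (Fin 3) (Fin 3) L) (ι : L →+* ℂ) (T : GL (Fin 3) ℂ)
  (hT : (T : Matrix (Fin 3) (Fin 3) ℂ)ᴴ * H.map ι * (T : Matrix (Fin 3) (Fin 3) ℂ) = Literature.Geometry.ComplexHyperbolic.BallModel.J)
  (μ : Measure (Gp L H).automorphicQuotient) [(Gp L H).IsAutomorphicMeasure μ]
  [MeasurableSpace (Gp L H).Adelic] [BorelSpace (Gp L H).Adelic]
  (𝔰 : Sockets L H μ) (gh : GHSide L H ι T hT 𝔰.PacketG 𝔰.PacketH) (ξd : XiSide L H 𝔰.PacketG 𝔰.PacketH)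
  (μω : HeckeCharacter L) (hμu : μω.IsUnitary) (c : ℚ) (jInf dsInf : ℤ → ℤ → ℤ → Cinf)
  (archTr : Cinf → (UnitaryGroup.arch (↥(maximalRealSubfield L)) L (IsCMField.complexConj L) 3 H → ℂ) → ℂ)
  (ν : Measure (Gp L H).Adelic) [IsFiniteMeasureOnCompacts ν]
  (μv : ∀ v : Places L, @Measure ((cmDatum L 3 H).Local v) (borel _))

/-! ## §1 K1′ — the kit of record at `ramCls₀ := F0P3RamClsOfRecord.ramCls₀` is PINNED (zero residual hypotheses) -/

/-- **K1′: `𝔠₀` AT THE EXACT RAMIFICATION SET OF RECORD IS PINNED** — pins (i)–(x) with no hypothesis beyond the compact CM frame (`hdef`, `h2`) and the Haar family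
`hμv`: ★ K1 `isPinned_kitOfRecord` with `hram := (mem_ramCls₀_iff_not_isSpherical).2` (R-12) and pin (x) `hx := ramCls₀_rep_cl_finite_of_isCot` (R-23: hol + antihol).
[cite: Rogawski1990, §14.5 p. 237; §13.7 p. 206] [cite: FlathCorvallis1979, Thm. 3] [cite: Dixmier1977, §13.1.3] -/
theorem isPinned_kitOfRecord₀
    (hdef : ∀ τ' : L →+* ℂ, InfinitePlace.mk τ' ≠ InfinitePlace.mk ι → (H.map τ').PosDef) (h2 : 2 ≤ Module.finrank ℚ ↥(maximalRealSubfield L))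
    (hμv : ∀ v : Places L, letI : MeasurableSpace ((cmDatum L 3 H).Local v) := borel _; (μv v).IsHaarMeasure) :
    (kitOfRecord L H ι T hT μ 𝔰 gh ξd μω c jInf dsInf archTr ν μv ramCls₀).IsPinned :=
  isPinned_kitOfRecord L H ι T hT μ 𝔰 gh ξd μω c jInf dsInf archTr ν μv ramCls₀ hdef h2 hμv
    (fun P v h => (mem_ramCls₀_iff_not_isSpherical P v).2 h)
    (fun P hP _ => ramCls₀_rep_cl_finite_of_isCot ι T hT hdef h2 P hP)

/-! ## §2 Rows #16 and #22 inline -/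

section AnyRam

variable (ramCls₀' : DiscreteAutomorphicRep (Gp L H) μ → Set (Places L))

/-- **Row #16 `TokenInf` at 𝔠₀ for BOTH cotangent types** (★ (B-ii) `tokenInfU_of_isCot`: F1a in-house at the CM frame + a coh-unitary token, hol directly and antihol by
`P ↦ P̄`). [cite: Rogawski1990, Prop. 15.2.1 (b); §15.3] [cite: BorelWallach2000, VI Thm. 4.11] [cite: HarishChandra1953, Thm. 9] -/
theorem tokenInf_kitOfRecord
    (hdef : ∀ τ' : L →+* ℂ, InfinitePlace.mk τ' ≠ InfinitePlace.mk ι → (H.map τ').PosDef) (h2 : 2 ≤ Module.finrank ℚ ↥(maximalRealSubfield L)) :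
    (kitOfRecord L H ι T hT μ 𝔰 gh ξd μω c jInf dsInf archTr ν μv ramCls₀').TokenInf :=
  fun P hP _ _ _ _ _ hM hirr htok => tokenInfU_of_isCot L H ι T hT μ hdef h2 (archDegOneClass 1 (Or.inl rfl)) P hP hM hirr htok

/-- **Row #22 `LocalIsotypyFin` at 𝔠₀ from `hAF`** (★ `localIsotypyFin₀_of_hAF`: every discrete automorphic `P` of `U(H)` has an irreducible ADMISSIBLE finite component
⇒ all constituents at `v` equal `clFinChoice (rep (cl P)) v`). [cite: FlathCorvallis1979, Thm. 3] [cite: BorelJacquet1979, §4.6] [cite: Rogawski1990, §14.5 p. 237] -/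
theorem localIsotypyFin_kitOfRecord_of_hAF
    (hAF : ∀ P : DiscreteAutomorphicRep (Gp L H) μ,
      ∃ (W : Type) (_ : AddCommGroup W) (_ : Module ℂ W)
        (σ : Representation ℂ (finAdelic (↥(maximalRealSubfield L)) L (IsCMField.complexConj L) 3 H) W),
        σ.IsIrreducible ∧ σ.IsAdmissible ∧ P.HasFinComponent σ) :
    (kitOfRecord L H ι T hT μ 𝔰 gh ξd μω c jInf dsInf archTr ν μv ramCls₀').LocalIsotypyFin :=
  localIsotypyFin₀_of_hAF L H hAF

/-! ## §3 K7 ED. 2 — `Laws` with #16 discharged and #22 from `hAF` -/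

/-- **K7 ED. 2: `(kitOfRecord …).Laws μω hμu`** — ★ K7 `laws_kitOfRecord_of` with the antihol `TokenInf` hypothesis DISCHARGED (§2) and `LocalIsotypyFin` from `hAF` (§2);
remaining named hypotheses: E-rows `h1 h2' h3 h4 h5 h6 h7` (T1∕(J2′) exports; #6∕#7 close from the pins at K9), L∕Δ-rows `h8 h10 h12 h13 h14 h15`, the arch clauses `hμω hJ hD`,
`hAF`, and the ξ-side rows `h20 h21 h23` on `ξd`. [cite: Rogawski1990, §14.6 Thm. 14.6.4 pp. 236–244] -/
theorem laws_kitOfRecord_of₂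
    (hdef : ∀ τ' : L →+* ℂ, InfinitePlace.mk τ' ≠ InfinitePlace.mk ι → (H.map τ').PosDef) (h2 : 2 ≤ Module.finrank ℚ ↥(maximalRealSubfield L))
    (h1 : (kitOfRecord L H ι T hT μ 𝔰 gh ξd μω c jInf dsInf archTr ν μv ramCls₀').TraceIdentity)
    (h2' : (kitOfRecord L H ι T hT μ 𝔰 gh ξd μω c jInf dsInf archTr ν μv ramCls₀').SpectralSideGp)
    (h3 : (kitOfRecord L H ι T hT μ 𝔰 gh ξd μω c jInf dsInf archTr ν μv ramCls₀').Factorisation)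
    (h4 : (kitOfRecord L H ι T hT μ 𝔰 gh ξd μω c jInf dsInf archTr ν μv ramCls₀').MatchingS)
    (h5 : (kitOfRecord L H ι T hT μ 𝔰 gh ξd μω c jInf dsInf archTr ν μv ramCls₀').TransferS)
    (h6 : (kitOfRecord L H ι T hT μ 𝔰 gh ξd μω c jInf dsInf archTr ν μv ramCls₀').HatBounded)
    (h7 : (kitOfRecord L H ι T hT μ 𝔰 gh ξd μω c jInf dsInf archTr ν μv ramCls₀').UnrStarAlgebra)
    (h8 : (kitOfRecord L H ι T hT μ 𝔰 gh ξd μω c jInf dsInf archTr ν μv ramCls₀').LinIndepS)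
    (h10 : (kitOfRecord L H ι T hT μ 𝔰 gh ξd μω c jInf dsInf archTr ν μv ramCls₀').UnitaryPacket)
    (h12 : (kitOfRecord L H ι T hT μ 𝔰 gh ξd μω c jInf dsInf archTr ν μv ramCls₀').FlathDet)
    (h13 : (kitOfRecord L H ι T hT μ 𝔰 gh ξd μω c jInf dsInf archTr ν μv ramCls₀').APacketSpectral)
    (h14 : (kitOfRecord L H ι T hT μ 𝔰 gh ξd μω c jInf dsInf archTr ν μv ramCls₀').LocalExpansion)
    (h15 : (kitOfRecord L H ι T hT μ 𝔰 gh ξd μω c jInf dsInf archTr ν μv ramCls₀').Routing)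
    (hμω : ∀ x : Literature.NumberTheory.GaloisRepresentations.ideleGroup ↥(maximalRealSubfield L),
      μω (AdeleRing.ideleBaseChange (↥(maximalRealSubfield L)) L x) = quadraticHeckeCharCM L x)
    (hJ : JInfNoDegOne jInf) (hD : DsInfNoDegOne dsInf)
    (hAF : ∀ P : DiscreteAutomorphicRep (Gp L H) μ,
      ∃ (W : Type) (_ : AddCommGroup W) (_ : Module ℂ W)
        (σ : Representation ℂ (finAdelic (↥(maximalRealSubfield L)) L (IsCMField.complexConj L) 3 H) W),
        σ.IsIrreducible ∧ σ.IsAdmissible ∧ P.HasFinComponent σ)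
    (h20 : (kitOfRecord L H ι T hT μ 𝔰 gh ξd μω c jInf dsInf archTr ν μv ramCls₀').XiFamilyFin μω hμu)
    (h21 : (kitOfRecord L H ι T hT μ 𝔰 gh ξd μω c jInf dsInf archTr ν μv ramCls₀').XiUnram)
    (h23 : (kitOfRecord L H ι T hT μ 𝔰 gh ξd μω c jInf dsInf archTr ν μv ramCls₀').EvpConvention) :
    (kitOfRecord L H ι T hT μ 𝔰 gh ξd μω c jInf dsInf archTr ν μv ramCls₀').Laws μω hμu :=
  laws_kitOfRecord_of L H ι T hT μ 𝔰 gh ξd μω hμu c jInf dsInf archTr ν μv ramCls₀' hdef h2 h1 h2' h3 h4 h5 h6 h7 h8 h10 h12 h13 h14 h15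
    (fun P hP _ _ _ _ _ hM hirr htok =>
      F0P3AntiholCohUnitaryToken.tokenInfU_of_isAntiholCotangentAt L H ι T hT μ hdef h2 (archDegOneClass 1 (Or.inl rfl)) P hP hM hirr htok)
    hμω hJ hD h20 h21 (localIsotypyFin_kitOfRecord_of_hAF L H ι T hT μ 𝔰 gh ξd μω c jInf dsInf archTr ν μv ramCls₀' hAF) h23

end AnyRam

end Summit.HodgeConjecture.HodgeConjecture.Cruxes.H413.F0P3KitOfRecord

end
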